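import Mathlib
import Literature.NumberTheory.LFunctions.WeilExplicit
import Literature.NumberTheory.LFunctions.ZetaZeros

/-!
# Sketch — crux ideas for `SignCone.OscCoherentCore` (stmt-RiemannHypothesis-18013), ideator k = 2, round 1

First lemmas of the two idea cards, typed over existing declarations (nothing is proved here;
every `def … : Prop` is a target statement, and the two `theorem`s are elementary sanity checks).

* Card `verified-height-crossover`: `ReLogDerivZetaCriticalLine` (exact, unconditional:
  `Re ζ'/ζ(1/2+it) = (log π − Re ψ(1/4+it/2))/2`, from the reality of `ξ` on the critical line),
  `primePolyBound`, `HighFreqSymbolNonneg`, `HighPassSlackWeil`.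
* Card `offline-defect-cubic-law`: `offLineDefectKernel`, `OffLineDefectPairBound`,
  `ProjectedHalfLineValueNonneg`, `WindowedOffLineSecondMoment`.
-/

noncomputable section

open Complex MeasureTheory Set Filter
open scoped Real ComplexConjugate ArithmeticFunction.vonMangoldt

namespace Summit.RiemannHypothesis.RiemannHypothesis.Cruxes.OscCoherentCore.IdeatorTwo

open Literature.NumberTheory.LFunctions

/-! ## Card 1 — verified-height crossover ledger -/

/-- FIRST LEMMA (card 1). On the critical line the real part of `ζ'/ζ` is an explicit elementary
function, unconditionally: `Re (ζ'/ζ)(1/2 + it) = (log π − Re ψ(1/4 + it/2)) / 2` whenever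
`ζ(1/2 + it) ≠ 0` (reality of `ξ(1/2+it)` makes `ξ'/ξ` purely imaginary there, and
`Re (1/s + 1/(s-1)) = 0` on `Re s = 1/2`). Equivalently the archimedean symbol of the route,
`Re ψ(1/4+it/2) − log π`, equals `−2 Re (ζ'/ζ)(1/2+it)` exactly. -/
def ReLogDerivZetaCriticalLine : Prop :=
  ∀ t : ℝ, riemannZeta (1 / 2 + t * I) ≠ 0 →
    (deriv riemannZeta (1 / 2 + t * I) / riemannZeta (1 / 2 + t * I)).re
      = (Real.log Real.pi - (Complex.digamma (1 / 4 + t / 2 * I)).re) / 2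

/-- `B(x) = 2 ∑_{n ≤ x} Λ(n)/√n`: the trivial bound for `2 Re ∑_{n ≤ x} Λ(n) n^{-1/2-it}`,
i.e. for the symbol of the prime term `P_Λ` on tests supported in `[−log x, log x]`. -/
def primePolyBound (x : ℝ) : ℝ :=
  2 * ∑ n ∈ Finset.Icc 1 ⌊x⌋₊, Λ n / Real.sqrt n

/-- The CROSSOVER: above height `T` the archimedean-plus-slack symbol beats every prime polynomial
of length `x`: `1 + Re ψ(1/4 + it/2) − log π ≥ B(x)` for `|t| ≥ T`. (Elementary: `Re ψ(1/4+it/2)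
≥ log(|t|/2) − O(1/t)` by the tree's `re_digamma_ge`; holds as soon as `log (T/2π) ≳ B(x) − 1`.) -/
def HighFreqSymbolNonneg (x T : ℝ) : Prop :=
  ∀ t : ℝ, T ≤ |t| → primePolyBound x ≤ 1 + (Complex.digamma (1 / 4 + t / 2 * I)).re - Real.log Real.pi

/-- The RESIDUAL of the ledger above the verified height (what remains of the crux for cutoffs
beyond the crossover): unit-slack Weil positivity for HIGH-PASS autocorrelation tests —
`Re W(g ⋆ g̃) ≥ −‖g‖₂²` for every Weil test `g` supported in `[−a, a]` whose spectral mass below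
height `Ω` is at most `ε‖g‖₂²` (stated with an explicit leakage parameter `ε`). Under RH it holds with
`W ≥ 0`; it is implied by `WindowedOffLineSecondMoment` (card 2) at heights `≥ Ω − 1`. -/
def HighPassSlackWeil (a Ω ε : ℝ) : Prop :=
  ∀ g : ℝ → ℂ, IsWeilTest g → tsupport g ⊆ Icc (-a) a →
    (∫ t in Icc (-Ω) Ω, ‖weilMellin g (1 / 2 + t * I)‖ ^ 2) ≤ ε * (2 * π) * ∫ t, ‖g t‖ ^ 2 →
    -(∫ t, ‖g t‖ ^ 2) ≤ (weilQuadratic g).re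

/-! ## Card 2 — off-line defect ledger (cubic-in-cutoff law) -/

/-- The defect weight of an off-line pair `{ρ, 1 − ρ̄}`, `ρ = 1/2 + δ + iγ`, against a test supported
in `[−2a, 2a]`: `e^{δu} + e^{−δu} − 2 = 4 sinh²(δu/2)` — quadratic in `δ`, and of total mass
`∫_{−2a}^{2a} 4 sinh² (δu/2) du = (16/3) δ² a³ (1 + O(δ²a²))`. -/
def offLineDefectKernel (δ u : ℝ) : ℝ :=
  4 * Real.sinh (δ * u / 2) ^ 2

/-- Sanity check: the kernel is the exact second-order remainder of the tilt. -/
theorem offLineDefectKernel_eq (δ u : ℝ) :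
    offLineDefectKernel δ u = Real.exp (δ * u) + Real.exp (-(δ * u)) - 2 := by
  unfold offLineDefectKernel
  rw [Real.sinh_eq]
  have h : Real.exp (δ * u) = Real.exp (δ * u / 2) * Real.exp (δ * u / 2) := by
    rw [← Real.exp_add]; ring_nf
  have h' : Real.exp (-(δ * u)) = Real.exp (-(δ * u / 2)) * Real.exp (-(δ * u / 2)) := by
    rw [← Real.exp_add]; ring_nf
  have hinv : Real.exp (δ * u / 2) * Real.exp (-(δ * u / 2)) = 1 := by
    rw [← Real.exp_add, add_neg_cancel, Real.exp_zero]
  rw [h, h']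
  nlinarith [hinv]

/-- FIRST LEMMA (card 2): the PAIR DEFECT BOUND. For a compactly supported continuous `F` and any
`ρ`, the contribution of the pair `{ρ, 1 − ρ̄}` to the zero side differs from twice the
critical-line value `F̂(Im ρ) = M_F(1/2 + i Im ρ)` by at most the defect-kernel integral:
`‖M_F(ρ) + M_F(1 − ρ̄) − 2 M_F(1/2 + i Im ρ)‖ ≤ ∫ ‖F u‖ · 4 sinh²((Re ρ − 1/2) u / 2) du`.
(`M_F = weilMellin F`; elementary from `offLineDefectKernel_eq` and `‖∫ f‖ ≤ ∫ ‖f‖`.) -/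
def OffLineDefectPairBound : Prop :=
  ∀ (F : ℝ → ℂ), Continuous F → HasCompactSupport F → ∀ ρ : ℂ,
    ‖weilMellin F ρ + weilMellin F (1 - conj ρ) - 2 * weilMellin F (1 / 2 + ρ.im * I)‖
      ≤ ∫ u : ℝ, ‖F u‖ * offLineDefectKernel (ρ.re - 1 / 2) u

/-- The PROJECTED zero side is a positive functional for free: for an autocorrelation
`F = g ⋆ g̃`, `M_F(1/2 + it) = |ĝ(1/2+it)|² ≥ 0` at EVERY real `t` — in particular at the ordinate
of every zero, on the line or not. (In the tree: `weilMellin_weilConv` + `weilMellin_weilReflect`.) -/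
def ProjectedHalfLineValueNonneg : Prop :=
  ∀ g : ℝ → ℂ, IsWeilTest g → ∀ t : ℝ,
    0 ≤ (weilMellin (weilConv g (weilReflect g)) (1 / 2 + t * I)).re ∧
      (weilMellin (weilConv g (weilReflect g)) (1 / 2 + t * I)).im = 0

/-- TRANSFER target `D(a)` (card 2): the WINDOWED OFF-LINE SECOND MOMENT law — in every height
window of width `2/a`, the multiplicity-weighted sum of `(Re ρ − 1/2)²` over zeros of `ζ` OFF the
critical line is at most `C (1 + log (2 + |t|)) / a³`. For each fixed `a` strictly weaker than RH
(empty sum under RH); `∀ a, D(a)` is RH. Via `OffLineDefectPairBound` + `ProjectedHalfLineValueNonneg`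
+ `explicit_formula` it implies the unit-slack sign-cone inequality at cutoff `a` (constant `C`
explicit, `≈ 3/16`). -/
def WindowedOffLineSecondMoment (a C : ℝ) : Prop :=
  ∀ t : ℝ, ∀ S : Finset ℂ,
    (∀ ρ ∈ S, riemannZeta ρ = 0 ∧ 0 < ρ.re ∧ ρ.re < 1 ∧ ρ.re ≠ 1 / 2 ∧ |ρ.im - t| ≤ 1 / a) →
    ∑ ρ ∈ S, (riemannZetaZeroOrder ρ : ℝ) * (ρ.re - 1 / 2) ^ 2
      ≤ C * (1 + Real.log (2 + |t|)) / a ^ 3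

/-- Degenerate sanity check: under RH the windowed law holds with any `C ≥ 0` (the sum is empty). -/
theorem windowedOffLineSecondMoment_of_rh (hRH : RiemannHypothesis) {a C : ℝ} (ha : 0 < a)
    (hC : 0 ≤ C) : WindowedOffLineSecondMoment a C := by
  intro t S hS
  have hS0 : ∀ ρ ∈ S, (riemannZetaZeroOrder ρ : ℝ) * (ρ.re - 1 / 2) ^ 2 = 0 := by
    intro ρ hρ
    obtain ⟨hz, h0, h1, hne, -⟩ := hS ρ hρ
    exfalso
    apply hne
    refine hRH ρ hz ?_ ?_
    · rintro ⟨n, hn⟩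
      have : ρ.re = (-2 * ((n : ℂ) + 1)).re := by rw [hn]
      simp at this
      have hn0 : (0 : ℝ) ≤ n := Nat.cast_nonneg n
      linarith
    · intro h
      rw [h] at h1
      simp at h1
  rw [Finset.sum_eq_zero hS0]
  have : 0 ≤ Real.log (2 + |t|) := Real.log_nonneg (by linarith [abs_nonneg t])
  positivity

end Summit.RiemannHypothesis.RiemannHypothesis.Cruxes.OscCoherentCore.IdeatorTwo

end
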